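import Literature.Computability.AlgebraicComplexity.BI17FundamentalInvariantForms
import Literature.Computability.AlgebraicComplexity.RazElusiveGeneralExistence
import Literature.Computability.AlgebraicComplexity.MultiplicityObstructionsProofs
import HarnessLib

/-!
# Generic forms avoid the images of polynomial charts with too few parameters

A dimension-count criterion for BI 2017's "almost all forms" (`IsZariskiGeneric`), proved without any
dimension theory of varieties: if a family of degree-`D` forms in the variables `σ` is the image of a
POLYNOMIAL map in fewer than `N = #{monomials of degree D}` parameters, then a nonzero polynomial in
the `N` coefficients vanishes on the whole family, so a Zariski-generic form lies outside it.

The charts used here are the ones needed for stabilizer computations (Matsumura–Monsky 1964, as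
quoted by Bürgisser–Ikenmeyer 2017 §2.1 and Poonen 2005 Thm. 3): a *chart* is a square matrix `G`
whose entries are polynomials in parameters `ι` (an affine family of linear substitutions) together
with a finite set `S` of monomials (an affine family of forms `∑_{e ∈ S} y_e x^e`); its image is the
set of forms `G(p) · v` with `p ∈ K^ι` and `v` supported on `S` (`chartImage`). The parameter count
is `#ι + #S`.

* Tree inputs: `exists_aeval_eq_zero_of_card_lt` (`RazElusiveGeneralExistence`: more polynomials
  than variables are algebraically dependent, via Mathlib's transcendence degree) and
  `map_linSubst` (`MultiplicityObstructionsProofs`: linear substitution commutes with a change of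
  scalars).
* `coeffPoly`, `aeval_coeffPoly` — the coefficients of `G(p) · v` are the values at `(p, y)` of
  universal polynomials in the parameters.
* `isZariskiGeneric_not_mem_chartImage` — if `#ι + #S < N` then almost all forms of degree `D`
  avoid `chartImage G S`; `IsZariskiGeneric.forall_fintype` — finitely many generic properties hold
  simultaneously generically.

Consumer: `GenericTrivialStabilizerProofs.lean` (the cell `val-lit` discharge of
`BI2017_matsumuraMonsky_trivialStabilizer`). Honest framing: classical bookkeeping; nothing here
bears on VP versus VNP. [cite: BurgisserIkenmeyer2017, §2.1 ("almost all w ∈ Sym^D ℂ^m")]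

## References

* P. Bürgisser, C. Ikenmeyer, *Fundamental invariants of orbit closures*, J. Algebra 477 (2017),
  §2.1. [BurgisserIkenmeyer2017]
* H. Matsumura, P. Monsky, *On the automorphisms of hypersurfaces*, J. Math. Kyoto Univ. 3
  (1963/64) 347–361 (the dimension count behind "almost all forms have a trivial stabilizer").
  [MatsumuraMonsky1963]
-/

noncomputable section

open MvPolynomial

namespace Literature.Computability.AlgebraicComplexity

/-! ### Charts: affine families of linear substitutions applied to affine families of forms -/

section Chart

variable {σ : Type*} [Fintype σ] {K : Type*} [Field K] {ι : Type*}

/-- The image of the chart `(G, S)`: all forms `G(p) · (∑_{e ∈ S} y_e x^e)` for parameter values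
`p : ι → K` and coefficients `y`. [cite: BurgisserIkenmeyer2017, §2.1 ("almost all w")] -/
def chartImage (G : Matrix σ σ (MvPolynomial ι K)) (S : Finset (σ →₀ ℕ)) :
    Set (MvPolynomial σ K) :=
  {f | ∃ (p : ι → K) (y : (σ →₀ ℕ) → K),
    f = linSubst σ K (G.map (MvPolynomial.eval p)) (∑ e ∈ S, y e • monomial e 1)}

/-- Membership in `chartImage`, unfolded. [cite: BurgisserIkenmeyer2017, §2.1 ("almost all w")] -/
theorem mem_chartImage_iff {G : Matrix σ σ (MvPolynomial ι K)} {S : Finset (σ →₀ ℕ)}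
    {f : MvPolynomial σ K} :
    f ∈ chartImage G S ↔ ∃ (p : ι → K) (y : (σ →₀ ℕ) → K),
      f = linSubst σ K (G.map (MvPolynomial.eval p)) (∑ e ∈ S, y e • monomial e 1) :=
  Iff.rfl

omit [Fintype σ] in
/-- A polynomial supported on `S` is the sum over `S` of its coefficients times monomials.
[folklore] -/
private theorem eq_sum_coeff_smul_monomial_of_support_subset {v : MvPolynomial σ K}
    {S : Finset (σ →₀ ℕ)} (hv : v.support ⊆ S) :
    v = ∑ e ∈ S, coeff e v • monomial e (1 : K) := by
  conv_lhs => rw [v.as_sum]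
  rw [Finset.sum_subset hv fun e _ he => by rw [notMem_support_iff.mp he, monomial_zero]]
  refine Finset.sum_congr rfl fun e _ => ?_
  rw [smul_monomial, smul_eq_mul, mul_one]

/-- Forms `G(p) · v` with `v` supported on `S` lie in the chart image.
[cite: BurgisserIkenmeyer2017, §2.1 ("almost all w")] -/
theorem linSubst_mem_chartImage (G : Matrix σ σ (MvPolynomial ι K)) {S : Finset (σ →₀ ℕ)}
    (p : ι → K) {v : MvPolynomial σ K} (hv : v.support ⊆ S) :
    linSubst σ K (G.map (MvPolynomial.eval p)) v ∈ chartImage G S :=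
  ⟨p, fun e => coeff e v, by rw [← eq_sum_coeff_smul_monomial_of_support_subset hv]⟩

/-- The universal form of the chart: `∑_{e ∈ S} Y_e x^e` over the parameter ring
`K[X_i, Y_e : i ∈ ι, e ∈ S]`. [cite: BurgisserIkenmeyer2017, §2.1 ("almost all w")] -/
def univForm (ι : Type*) (S : Finset (σ →₀ ℕ)) :
    MvPolynomial σ (MvPolynomial (ι ⊕ ↥S) K) :=
  ∑ e : ↥S, C (X (Sum.inr e)) * monomial e.1 1

/-- The universal matrix of the chart: `G` with its parameters viewed in the bigger parameter ring.
[cite: BurgisserIkenmeyer2017, §2.1 ("almost all w")] -/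
def univMatrix (G : Matrix σ σ (MvPolynomial ι K)) (S : Finset (σ →₀ ℕ)) :
    Matrix σ σ (MvPolynomial (ι ⊕ ↥S) K) :=
  G.map (rename (Sum.inl : ι → ι ⊕ ↥S))

/-- The universal coefficient polynomial of the chart at the monomial `d`: the coefficient of `x^d` in
`G · (∑_{e ∈ S} Y_e x^e)`, a polynomial in the parameters `X_i, Y_e`.
[cite: BurgisserIkenmeyer2017, §2.1 ("almost all w")] -/
def coeffPoly (G : Matrix σ σ (MvPolynomial ι K)) (S : Finset (σ →₀ ℕ)) (d : σ →₀ ℕ) :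
    MvPolynomial (ι ⊕ ↥S) K :=
  coeff d (linSubst σ _ (univMatrix G S) (univForm (K := K) ι S))

omit [Fintype σ] in
/-- Specialisation of the universal matrix at parameter values `(p, y)` is `G(p)`.
[cite: BurgisserIkenmeyer2017, §2.1 ("almost all w")] -/
theorem univMatrix_map_eval (G : Matrix σ σ (MvPolynomial ι K)) (S : Finset (σ →₀ ℕ))
    (p : ι → K) (y : ↥S → K) :
    (univMatrix G S).map (MvPolynomial.eval (Sum.elim p y)) = G.map (MvPolynomial.eval p) := by
  ext i j
  simp only [univMatrix, Matrix.map_apply, eval_rename, Sum.elim_comp_inl]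

omit [Fintype σ] in
/-- Specialisation of the universal form at parameter values `(p, y)` is `∑_{e ∈ S} y_e x^e`.
[cite: BurgisserIkenmeyer2017, §2.1 ("almost all w")] -/
theorem map_eval_univForm (S : Finset (σ →₀ ℕ)) (p : ι → K) (y : ↥S → K) :
    MvPolynomial.map (MvPolynomial.eval (Sum.elim p y)) (univForm (K := K) ι S) =
      ∑ e : ↥S, y e • monomial e.1 1 := by
  simp only [univForm, map_sum, map_mul, map_C, eval_X, Sum.elim_inr, map_monomial, map_one,
    smul_eq_C_mul]

/-- **The coefficients of a chart form are values of the universal coefficient polynomials**: for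
parameter values `(p, y)`, the coefficient of `x^d` in `G(p) · (∑_{e ∈ S} y_e x^e)` is
`coeffPoly G S d` evaluated at `(p, y)`. [cite: BurgisserIkenmeyer2017, §2.1 ("almost all w")] -/
theorem eval_coeffPoly (G : Matrix σ σ (MvPolynomial ι K)) (S : Finset (σ →₀ ℕ))
    (p : ι → K) (y : ↥S → K) (d : σ →₀ ℕ) :
    MvPolynomial.eval (Sum.elim p y) (coeffPoly G S d) =
      coeff d (linSubst σ K (G.map (MvPolynomial.eval p)) (∑ e : ↥S, y e • monomial e.1 1)) := by
  rw [coeffPoly, ← coeff_map, map_linSubst, univMatrix_map_eval G S p y, map_eval_univForm]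

end Chart

/-! ### The criterion -/

section Criterion

variable {σ : Type*} [Fintype σ] {K : Type*} [Field K] {ι : Type*}

omit [Fintype σ] in
/-- A sum over a finset of monomials with arbitrary coefficients is the corresponding sum over the
attached subtype. [folklore] -/
private theorem sum_smul_monomial_eq_sum_attach (S : Finset (σ →₀ ℕ)) (y : (σ →₀ ℕ) → K) :
    (∑ e ∈ S, y e • monomial e (1 : K)) = ∑ e : ↥S, y e.1 • monomial e.1 1 := by
  rw [← Finset.sum_coe_sort]

/-- **Dimension-count criterion.** If the chart `(G, S)` has fewer parameters than there are
monomials of degree `D` (`#ι + #S < N`), then almost all forms of degree `D` lie outside its image: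
the `N` universal coefficient polynomials are algebraically dependent, and a nonzero relation
between them is a polynomial in the coefficients vanishing on the image. (The dimension count of
Matsumura–Monsky 1964 behind BI 2017 §2.1 "almost all `w ∈ Sym^D ℂ^m` have a trivial stabilizer",
in polynomial-identity form.) [cite: BurgisserIkenmeyer2017, §2.1 ("almost all w")] -/
theorem isZariskiGeneric_not_mem_chartImage [DecidableEq σ] [Fintype ι] (D : ℕ)
    (G : Matrix σ σ (MvPolynomial ι K)) (S : Finset (σ →₀ ℕ))
    (hcard : Fintype.card ι + S.card < (degMonomials σ D).card) :
    IsZariskiGeneric D fun f : MvPolynomial σ K => f ∉ chartImage G S := by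
  classical
  -- the universal coefficient polynomials, indexed by the degree-`D` monomials
  let Ψ : DegIdx σ D → MvPolynomial (ι ⊕ ↥S) K := fun d => coeffPoly G S d.1
  have hlt : Fintype.card (ι ⊕ ↥S) < Fintype.card (DegIdx σ D) := by
    rwa [Fintype.card_sum, Fintype.card_coe, Fintype.card_coe]
  obtain ⟨Φ, hΦ0, hΦ⟩ := exists_aeval_eq_zero_of_card_lt hlt Ψ
  refine ⟨Φ, hΦ0, fun f _ hFf hmem => hFf ?_⟩
  obtain ⟨p, y, rfl⟩ := hmem
  -- the coefficient vector of the chart form is the specialisation of `Ψ` at `(p, y)`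
  have hcoeff : formCoeff D (linSubst σ K (G.map (MvPolynomial.eval p))
      (∑ e ∈ S, y e • monomial e 1)) =
      fun d => aeval (Sum.elim p fun e : ↥S => y e.1) (Ψ d) := by
    funext d
    change coeff d.1 _ = MvPolynomial.eval (Sum.elim p fun e : ↥S => y e.1) (coeffPoly G S d.1)
    rw [eval_coeffPoly, sum_smul_monomial_eq_sum_attach]
  have h2 : aeval (fun d => aeval (Sum.elim p fun e : ↥S => y e.1) (Ψ d)) Φ =
      aeval (Sum.elim p fun e : ↥S => y e.1) (aeval Ψ Φ) := by
    rw [← comp_aeval]; rfl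
  rw [hcoeff, h2, hΦ, map_zero]

/-- Finitely many Zariski-generic properties hold simultaneously for almost all forms (product of
the test polynomials). [cite: BurgisserIkenmeyer2017, §2.1 ("almost all w")] -/
theorem IsZariskiGeneric.forall_fintype [DecidableEq σ] {D : ℕ} {A : Type*} [Fintype A]
    {P : A → MvPolynomial σ K → Prop} (h : ∀ a, IsZariskiGeneric D (P a)) :
    IsZariskiGeneric D fun f : MvPolynomial σ K => ∀ a, P a f := by
  classical
  choose F hF0 hF using h
  refine ⟨∏ a, F a, Finset.prod_ne_zero_iff.mpr fun a _ => hF0 a, fun f hf hne a => hF a f hf ?_⟩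
  rw [map_prod] at hne
  exact Finset.prod_ne_zero_iff.mp hne a (Finset.mem_univ a)

end Criterion

end Literature.Computability.AlgebraicComplexity
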